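import Summits.ResolutionOfSingularities.ResolutionOfSingularities.Theses.RadicialJung
import Literature.AlgebraicGeometry.Resolution.ProjectiveSpaceRegular

/-!
# Disproof of `CleanModels` (crux stmt-ResolutionOfSingularities-15917, route RadicialJung) — work file

Crux (rank 2, "the dodge"): for `p` prime, `k` ANY field of char `p`, `W/k` regular integral separated of
finite type, `L/K(W)` purely inseparable of degree `p`, SOME proper birational regular `π : V → W` is
pointwise LOG-CLEAN: at every `v ∈ V` some `g = y^p ∈ L^p ∖ K(W)^p` has `π^*g` of toroidal type
(`∏_{i<m} t_i^{a_i}`, `(t_i)` a regular system of parameters of `𝒪_{V,v}`, `0 < m ≤ dim`, `p ∤ a_i`) or of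
regular type (a unit `u₀`, residually a non-`p`-th power (i), or `u₀ − c^p ∈ 𝔪 ∖ 𝔪²` (ii)).

## Findings of cdisprove cycle 1 (2026-08-16). Kernel-checked unless marked COMMENT.

**No kill.** The statement is precise where testable and its open content is a genuine open problem
(base dimension ≥ 4; Zariski-local form in dimension 3). What this file proves:

* §0 `cleanModels_iff` — the crux is VERBATIM "hypotheses ⇒ ∃ model, ∀ v, toroidal ∨ regular" with the
  two branches factored as `ToroidalAt` / `RegularAt` (by `Iff.rfl`), so the lemmas below speak about the
  crux itself.
* §1 (a) LOAD-BEARING HYPOTHESES.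
  - `cleanModels_false_without_finrank`: drop `finrank K(W) L = p` ⇒ FALSE (`L = K(W)`: no `y ∉ K(W)`).
  - `cleanModels_false_without_purelyInseparable`: drop `IsPurelyInseparable` ⇒ FALSE
    (`K(Spec 𝔽₂) = 𝔽₂ ⊂ 𝔽₄ = L`, degree 2: `y = (y²)²`, so `y² ∈ K ⇒ y ∈ K`).
  - COMMENT (prior seat rattack, paper): `LocallyOfFiniteType f` is load-bearing through EXCELLENCE —
    over a non-Japanese DVR `R` with `ĉ ∈ R̂ ∖ R`, `ĉ^p ∈ R`, `L = K(ĉ)`: `V = W` is forced and every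
    `g' ∈ L^p ∖ K^p` is a `p`-th power in `R̂`, so no branch holds; `IsSeparated f`, `QuasiCompact f`
    look like conveniences (no local normal form uses them); `Scheme.IsRegular W` cannot be dropped
    without turning the crux into resolution of `W` itself (unrefutable, = summit).
  - COMMENT: `CharP k p` / `p.Prime` only select the slot; composite or wrong characteristic is VACUOUS
    (no purely inseparable degree-`p` extension), never false.
* §2 (b) TIGHTNESS. `toroidalAt_genericPoint_false`: at the generic point `ξ` of ANY model the toroidal
  branch is impossible (`𝒪_{V,ξ} = K(V)` is a field, `dim = 0 < m ≤ d = 0`), so every proof must use the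
  regular branch (i) there (`g ∉ K(V)^p`, automatic from `y ∉ K(W)` and birationality).
* §3 (c) NATURAL STRENGTHENING REFUTED. `not_cleanModelsToroidalOnly`: deleting the regular-type
  disjunct makes the crux FALSE; the witness that the hypotheses are inhabited is built in Lean
  (`Witness`: `p = 2`, `k = 𝔽₂(s)`, `W = Spec k`, `L = K(W)[y]/(y² − s)`; `hyps_witness`), which also
  certifies NON-VACUITY of the crux in Lean (previous seats had it on paper only).
  COMMENT: the opposite strengthening "regular type only" is false as well, e.g. for `p = 5` (`W = 𝔸²`,
  `g = xy`: the multiplicative point `x∂ₓ − y∂_y` has residue ratio `−1 = 4`, whose blow-up orbit under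
  `λ ↦ {λ − 1, λ/(1 − λ)}` in `𝔽₅` is `4 → {3,3}`, `3 → {2,1}`, `2 → {1,3}` — it never dies, so EVERY
  model keeps a multiplicative point, where the regular branch and toroidal `m = 1` both force the
  foliation to be regular; only toroidal `m = 2` can hold there) — not landable: needs the factorisation
  of proper birational maps of regular surfaces into point blow-ups, absent from Mathlib.
* COMMENT (redundancies, information for the prover): the conjunct `y ∉ range (algebraMap K(W) L)` is
  IMPLIED by the point condition at any single point (a `p`-th power `c^p` is never `∏ t_i^{a_i}` with
  `p ∤ a_i` in the UFD `𝒪_{V,v}`, and `c^p − c'^p = (c − c')^p ∈ 𝔪^p ∪ 𝒪^×` kills (i) and (ii)); and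
  `0 < m` is implied by `y ∉ K(W)` (`m = 0` gives `π^*g = 1`). Both are harmless as typed.

## Why it resists (COMMENT — the analysis the provers should read)

1. MODEL-INDEPENDENT POINTS ARE CLEAN. A refutation must defeat EVERY proper birational regular model;
   the only points common to all models are the generic point (regular (i): `g ∉ K^p`) and the
   codimension-1 points of `W` (excellent DVR: the loop `p ∤ v(g') ⇒ toroidal` / unit with `ū ∉ κ^p ⇒ (i)`
   / `u − c^p` uniformiser ⇒ (ii) / else `g' ↦ (u − c^p)/t^{v}` terminates because `𝒪 → 𝒪̂` has
   geometrically regular generic fibre, so `g' ∉ K̂^p`). Hence `dim W ≤ 1` is TRUE with `V = W`, and any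
   counterexample lives in codimension ≥ 2, where Mathlib offers no control of all models (it does have
   `UniversallyClosed.eq_valuativeCriterion`, so a VALUATION-THEORETIC obstruction at centres would be
   formalisable in principle — none was found: a defect-`p` valuation only forces `ν(t₁) ∈ pΓ` /
   `Σ aᵢ ν(tᵢ) ∈ pΓ`, which is satisfiable).
2. DIMENSION 2, `k` PERFECT: TRUE, ZARISKI-LOCALLY (new this cycle; closes the planner's worry (iii)
   "algebraic `t_i` may cost extra blow-ups or fail" for surfaces). With `F = ker(dg) ⊂ T_W` the `p`-closed
   foliation of `L^p = K^p(g)` and `R_v := 𝒪_{V,v} ∩ L^p` (local ring of `V/F`):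
   (Z1) at a REGULAR point of `F` (any dimension): `R̂_v = k[[t₁, t₂^p, …, t_n^p]]` (Ekedahl's formal
        Frobenius; kernels commute with the flat base change `𝒪^p → 𝒪̂^p`, `𝒪` being `F`-finite), so
        `R_v` is regular and `𝔪_{R_v} 𝒪̂ ⊄ 𝔪̂²`: some generator `r ∈ 𝔪_{R_v}` is a regular PARAMETER of
        `𝒪_{V,v}` lying in `L^p ∖ K^p` — toroidal type `m = 1, a = 1`, algebraically.
   (Z2) at a MULTIPLICATIVE point (`ω ∼ α dlog x̂ + β dlog ŷ` formally, `α, β ∈ 𝔽_p^×`): clean ⟺ each of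
        the two families of smooth formal invariant branches (`ŷ = x̂^{λ₀} H(x̂^p)`, `H ∈ k[[T]]`, and
        symmetrically) contains an ALGEBRAIC curve germ `E = {e = 0}`, `E' = {e' = 0}`; "⇐" because the
        Weil divisor `a₀E + E'` (`a₀α + β ≡ 0`) is principal on `Spec R̂_v` (cut out by `x̂^{a₀}ŷ`), hence
        principal on `Spec R_v` (`Cl(R_v) ↪ Cl(R̂_v)`, `R_v` excellent normal), giving `r = w·e^{a₀}e' ∈ L^p`
        with `w ∈ 𝒪^×`, and `w = (w^r)^{a₀}(w^s)^p` (`r a₀ + s p = 1`) is absorbed: `t₁ = w^r e`, `t₂ = e'`.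
        In particular every CORNER of two exceptional curves is clean.
   (Z3) TERMINATION: blowing up a non-clean multiplicative point of residue ratio `λ` leaves non-clean
        points only along the chain in the missing direction, with ratios `λ−1, λ−2, …`; after `≤ p − 1`
        steps the ratio is `1`, one more blow-up makes `F` regular there and (Z1) applies. So Giraud's
        étale normal form (Giraud 1983, via Posva 2024 Thm 1 p. 2, read this session) upgrades to the
        crux's ZARISKI form at the cost of `≤ 2(p−1)` extra blow-ups per multiplicative point.
   Residue ratios `λ ∈ {0, 1}` resolve away; `λ ∉ {0,1}` persist for `p ≥ 5` (orbit computation above;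
   Posva p. 2 / Tziolas Rem 4.8) but ARE clean (toroidal `m = 2`): persistence is not an obstruction.
3. DIMENSION 3, `k = k̄`: étale-locally TRUE (Cossart 1987 / Posva 2024 Thm 1, corank 1); the Zariski
   upgrade along the 1-dimensional singular locus is plausible by (Z1)–(Z2)-type arguments, unverified.
4. DIMENSION ≥ 4: OPEN (`Literature.Barriers.ResolutionOfSingularities.DimensionFourFrontier`). A
   counterexample would be a regular 4-fold `W/𝔽̄_p` and a degree-`p` radicial `L` whose foliation
   `ker(dg)` admits NO log-smooth model — nothing in print comes close (Hauser–Perlega 2019 monsters are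
   height ≥ 3 hypersurface phenomena and `d(c^p) = 0` dissolves them; the catalogued monomialization
   failure `Cutkosky2014` (PROVED in tree) is a SEPARABLE degree-`p²+1` defect extension of surfaces and
   does not transfer: for purely inseparable degree `p` on surfaces clean = monomial models exist).
5. GROUND FIELD. CleanModels over the PRIME field `𝔽_p` in dimension `n + t` implies CleanModels over
   every FINITELY GENERATED `k` (`trdeg_𝔽ₚ k = t`) in dimension `n`: spread `W → Spec k` out to a regular
   `𝒲 → B` of finite type over `𝔽_p`, clean `𝒲`, restrict to the generic fibre (same local rings, same
   `K`, same `L`). So the imperfect-residue-field clauses (i)/(ii) are exercised already over `𝔽_p` at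
   non-closed points, and only NON-finitely-generated `k` (limits along inseparable ground extensions,
   barrier `RegularNotGeometricallyRegular`) is beyond this reduction. No counterexample mechanism found
   there either (constant extensions `K(s^{1/p})` are clean on `W` itself: (i) where `s ∉ κ(v)^p`, else
   `s − x^p` is a regular parameter).
6. LITERATURE this cycle: Posva 2024 (arXiv:2405.05735) pp. 1–2 read (Thm 1; Giraud's normal form
   `u = v^p + x^a`; non-resolvability of `x∂ₓ + λy∂_y`, `λ ∉ {0,1}`); local `lit search` tier DOWN,
   OpenAlex 429, zbMATH/arXiv 0 rows — search-degraded, nothing new citable against the crux;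
   `ledger negatives`: 0 for this summit's CleanModels-type statements; barrier catalogue: none bites.

Targets (`-- Targets`): none yet (no line picked, `stuck_stubs = []`).
-/

noncomputable section

set_option linter.dupNamespace false -- mandated namespace of this single-conjunct summit

namespace Summit.ResolutionOfSingularities.ResolutionOfSingularities.Cruxes.CleanModels.Disproof

open AlgebraicGeometry CategoryTheory Literature.AlgebraicGeometry.Resolution
open Summit.ResolutionOfSingularities.ResolutionOfSingularities.Theses.RadicialJung

universe u

/-! ## The pointwise predicate, factored out verbatim -/

/-- The TOROIDAL branch of the point condition of `CleanModels` at `v ∈ V` for `g ∈ K(W)`: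
`π^* g = ∏_{i<m} t_i^{a_i}`, `(t_1..t_d)` a minimal generating system of `𝔪_v`, `d = dim 𝒪_{V,v}`,
`0 < m ≤ d`, `p ∤ a_i` (verbatim from the route file). -/
def ToroidalAt (p : ℕ) {W V : Scheme.{0}} [IsIntegral W] [IsIntegral V] (π : V ⟶ W) [IsDominant π]
    (g : W.functionField) (v : V) : Prop :=
  ∃ (d m : ℕ) (hmd : m ≤ d) (t : Fin d → V.presheaf.stalk v) (a : Fin m → ℕ),
    Ideal.span (Set.range t) = IsLocalRing.maximalIdeal (V.presheaf.stalk v) ∧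
    ringKrullDim (V.presheaf.stalk v) = (d : WithBot ℕ∞) ∧ 0 < m ∧ (∀ i, ¬ p ∣ a i) ∧
    Literature.AlgebraicGeometry.Motives.RatFn.functionFieldMap π g =
      ∏ i : Fin m, (algebraMap (V.presheaf.stalk v) V.functionField (t (Fin.castLE hmd i))) ^ (a i)

/-- The REGULAR branch of the point condition of `CleanModels` at `v ∈ V` for `g ∈ K(W)`:
`π^* g = u₀` a unit of `𝒪_{V,v}`, residually not a `p`-th power, or `u₀ − c^p ∈ 𝔪_v ∖ 𝔪_v²`
(verbatim from the route file). -/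
def RegularAt (p : ℕ) {W V : Scheme.{0}} [IsIntegral W] [IsIntegral V] (π : V ⟶ W) [IsDominant π]
    (g : W.functionField) (v : V) : Prop :=
  ∃ u₀ : V.presheaf.stalk v, IsUnit u₀ ∧
    Literature.AlgebraicGeometry.Motives.RatFn.functionFieldMap π g =
      algebraMap (V.presheaf.stalk v) V.functionField u₀ ∧
    ((∀ c : V.presheaf.stalk v, u₀ - c ^ p ∉ IsLocalRing.maximalIdeal (V.presheaf.stalk v)) ∨
      (∃ c : V.presheaf.stalk v, u₀ - c ^ p ∈ IsLocalRing.maximalIdeal (V.presheaf.stalk v) ∧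
        u₀ - c ^ p ∉ IsLocalRing.maximalIdeal (V.presheaf.stalk v) ^ 2))

/-- The hypotheses of `CleanModels` on `(p, k, W, f, L)` bundled (verbatim conjuncts). -/
def Hyps (p : ℕ) (k : Type) [Field k] (W : Scheme.{0}) [IsIntegral W] (f : W ⟶ Spec (.of k))
    (L : Type) [Field L] [Algebra W.functionField L] : Prop :=
  IsSeparated f ∧ LocallyOfFiniteType f ∧ QuasiCompact f ∧ Scheme.IsRegular W ∧
    IsPurelyInseparable W.functionField L ∧ Module.finrank W.functionField L = p

/-- Sanity check: `CleanModels` is, verbatim, "hypotheses ⇒ ∃ proper birational regular model,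
pointwise (toroidal ∨ regular)". [folklore] -/
theorem cleanModels_iff :
    CleanModels ↔ ∀ p : ℕ, p.Prime → ∀ (k : Type) [Field k] [CharP k p] (W : Scheme.{0})
      [IsIntegral W] (f : W ⟶ Spec (.of k)) (L : Type) [Field L] [Algebra W.functionField L],
      IsSeparated f → LocallyOfFiniteType f → QuasiCompact f → Scheme.IsRegular W →
      IsPurelyInseparable W.functionField L → Module.finrank W.functionField L = p →
      ∃ (V : Scheme.{0}) (π : V ⟶ W) (_ : IsIntegral V) (_ : IsDominant π),
        IsProper π ∧ IsBirational π ∧ Scheme.IsRegular V ∧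
        ∀ v : V, ∃ (y : L) (g : W.functionField), y ∉ Set.range (algebraMap W.functionField L) ∧
          algebraMap W.functionField L g = y ^ p ∧ (ToroidalAt p π g v ∨ RegularAt p π g v) :=
  Iff.rfl

/-! ## (a) Load-bearing hypotheses -/

/-- `CleanModels` with the hypothesis `Module.finrank K(W) L = p` DROPPED. -/
def CleanModelsWithoutFinrank : Prop :=
  ∀ p : ℕ, p.Prime → ∀ (k : Type) [Field k] [CharP k p] (W : Scheme.{0})
    [IsIntegral W] (f : W ⟶ Spec (.of k)) (L : Type) [Field L] [Algebra W.functionField L],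
    IsSeparated f → LocallyOfFiniteType f → QuasiCompact f → Scheme.IsRegular W →
    IsPurelyInseparable W.functionField L →
    ∃ (V : Scheme.{0}) (π : V ⟶ W) (_ : IsIntegral V) (_ : IsDominant π),
      IsProper π ∧ IsBirational π ∧ Scheme.IsRegular V ∧
      ∀ v : V, ∃ (y : L) (g : W.functionField), y ∉ Set.range (algebraMap W.functionField L) ∧
        algebraMap W.functionField L g = y ^ p ∧ (ToroidalAt p π g v ∨ RegularAt p π g v)

/-- The degree hypothesis is load-bearing: without `finrank K(W) L = p` the statement is false —
witness `p = 2`, `k = 𝔽₂`, `W = Spec 𝔽₂`, `L = K(W)` itself (purely inseparable over itself),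
where no `y ∈ L` lies outside `K(W)`. [folklore] -/
theorem cleanModels_false_without_finrank : ¬ CleanModelsWithoutFinrank := by
  intro h
  have hreg : Scheme.IsRegular (Spec (.of (ZMod 2))) := Scheme.isRegular_Spec (.of (ZMod 2))
  obtain ⟨V, π, hV, _, -, -, -, hpt⟩ :=
    @h 2 Nat.prime_two (ZMod 2) _ _ (Spec (.of (ZMod 2))) _ (𝟙 _)
      (Spec (.of (ZMod 2))).functionField _ (Algebra.id _)
      inferInstance inferInstance inferInstance hreg inferInstance
  obtain ⟨y, g, hy, -, -⟩ := hpt (hV.nonempty.some)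
  exact hy ⟨y, rfl⟩


/-- `CleanModels` with the hypothesis `IsPurelyInseparable K(W) L` DROPPED. -/
def CleanModelsWithoutPurelyInseparable : Prop :=
  ∀ p : ℕ, p.Prime → ∀ (k : Type) [Field k] [CharP k p] (W : Scheme.{0})
    [IsIntegral W] (f : W ⟶ Spec (.of k)) (L : Type) [Field L] [Algebra W.functionField L],
    IsSeparated f → LocallyOfFiniteType f → QuasiCompact f → Scheme.IsRegular W →
    Module.finrank W.functionField L = p →
    ∃ (V : Scheme.{0}) (π : V ⟶ W) (_ : IsIntegral V) (_ : IsDominant π),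
      IsProper π ∧ IsBirational π ∧ Scheme.IsRegular V ∧
      ∀ v : V, ∃ (y : L) (g : W.functionField), y ∉ Set.range (algebraMap W.functionField L) ∧
        algebraMap W.functionField L g = y ^ p ∧ (ToroidalAt p π g v ∨ RegularAt p π g v)

/-- For a field `k`, the structure map `k → K(Spec k)` as an `Algebra` instance (Mathlib's instance is
keyed on `↑R` for `R : CommRingCat` and does not fire on a bare `k`). -/
abbrev specFunctionFieldAlgebra (k : Type) [Field k] : Algebra k (Spec (.of k)).functionField :=
  AlgebraicGeometry.instAlgebraCarrierFunctionFieldSpec (CommRingCat.of k)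

/-- For a field `k`, the function field of `Spec k` is `k`: the structure map is an isomorphism
(a field is its own fraction field). [folklore] -/
def specFunctionFieldEquiv (k : Type) [Field k] : k ≃+* (Spec (.of k)).functionField :=
  letI : Algebra k (Spec (.of k)).functionField := specFunctionFieldAlgebra k
  haveI : IsFractionRing k (Spec (.of k)).functionField :=
    AlgebraicGeometry.functionField_isFractionRing_of_affine (CommRingCat.of k)
  (IsLocalization.atUnits (S := (Spec (.of k)).functionField) k (nonZeroDivisors k)
    (fun _ hx => (IsUnit.mem_submonoid_iff _).mpr
      (isUnit_iff_ne_zero.mpr (nonZeroDivisors.ne_zero hx)))).toRingEquiv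

/-- Pure inseparability is load-bearing: without `IsPurelyInseparable K(W) L` the statement is false —
witness `p = 2`, `k = 𝔽₂`, `W = Spec 𝔽₂` (so `K(W) = 𝔽₂`), `L = 𝔽₄` (degree `2`, separable): no
`y ∈ 𝔽₄ ∖ 𝔽₂` has `y² ∈ 𝔽₂`, since `y = y⁴ = (y²)²`. [folklore] -/
theorem cleanModels_false_without_purelyInseparable : ¬ CleanModelsWithoutPurelyInseparable := by
  intro h
  let K := (Spec (.of (ZMod 2))).functionField
  let e : ZMod 2 ≃+* K := specFunctionFieldEquiv (ZMod 2)
  let L := GaloisField 2 2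
  letI : Algebra K L := ((algebraMap (ZMod 2) L).comp e.symm.toRingHom).toAlgebra
  have hfin : Module.finrank K L = 2 := by
    refine Eq.trans (Algebra.finrank_eq_of_equiv_equiv e (RingEquiv.refl L) ?_).symm
      (GaloisField.finrank 2 (n := 2) two_ne_zero)
    ext
    simp [RingHom.algebraMap_toAlgebra]
  have hreg : Scheme.IsRegular (Spec (.of (ZMod 2))) := Scheme.isRegular_Spec (.of (ZMod 2))
  obtain ⟨V, π, hV, _, -, -, -, hpt⟩ :=
    @h 2 Nat.prime_two (ZMod 2) _ _ (Spec (.of (ZMod 2))) _ (𝟙 _) L _ _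
      inferInstance inferInstance inferInstance hreg hfin
  obtain ⟨y, g, hy, hg, -⟩ := hpt (hV.nonempty.some)
  haveI : Fintype L := Fintype.ofFinite L
  have hcard : Fintype.card L = 4 := by
    rw [Fintype.card_eq_nat_card]; exact GaloisField.card 2 2 two_ne_zero
  have hy4 : y ^ 4 = y := by rw [← hcard]; exact FiniteField.pow_card y
  apply hy
  refine ⟨g ^ 2, ?_⟩
  rw [map_pow, hg, ← pow_mul]
  exact hy4

/-! ## (b) Tightness: the regular branch is forced at the generic point -/

/-- **The toroidal branch is impossible at the generic point** of `V`: there `𝒪_{V,ξ} = K(V)` is a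
field, `dim = 0`, and the clause demands `0 < m ≤ d = dim`. So ANY proof of `CleanModels` must use the
regular-type branch (i) (`g ∉ K(V)^p`) at `ξ`. [folklore] -/
theorem toroidalAt_genericPoint_false (p : ℕ) {W V : Scheme.{0}} [IsIntegral W] [IsIntegral V]
    (π : V ⟶ W) [IsDominant π] (g : W.functionField) : ¬ ToroidalAt p π g (genericPoint V) := by
  rintro ⟨d, m, hmd, t, a, -, hdim, hm, -, -⟩
  have h0 : ringKrullDim (V.presheaf.stalk (genericPoint V)) = 0 :=
    ringKrullDim_eq_zero_of_field V.functionField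
  rw [h0] at hdim
  have hd : d = 0 := by exact_mod_cast hdim.symm
  omega

/-! ## (c) A natural strengthening refuted: "toroidal type at every point" -/

/-- `CleanModels` STRENGTHENED by deleting the regular-type disjunct (toroidal type demanded at every
point of `V`). -/
def CleanModelsToroidalOnly : Prop :=
  ∀ p : ℕ, p.Prime → ∀ (k : Type) [Field k] [CharP k p] (W : Scheme.{0})
    [IsIntegral W] (f : W ⟶ Spec (.of k)) (L : Type) [Field L] [Algebra W.functionField L],
    IsSeparated f → LocallyOfFiniteType f → QuasiCompact f → Scheme.IsRegular W →
    IsPurelyInseparable W.functionField L → Module.finrank W.functionField L = p →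
    ∃ (V : Scheme.{0}) (π : V ⟶ W) (_ : IsIntegral V) (_ : IsDominant π),
      IsProper π ∧ IsBirational π ∧ Scheme.IsRegular V ∧
      ∀ v : V, ∃ (y : L) (g : W.functionField), y ∉ Set.range (algebraMap W.functionField L) ∧
        algebraMap W.functionField L g = y ^ p ∧ ToroidalAt p π g v

/-! ### A genuine instance of the hypotheses: `W = Spec 𝔽₂(s)`, `L = K(W)(√s)` -/

namespace Witness

/-- The ground field `𝔽₂(s)`. -/
abbrev k₂ : Type := RatFunc (ZMod 2)

/-- `W = Spec 𝔽₂(s)`. -/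
abbrev W₂ : Scheme.{0} := Spec (.of k₂)

/-- `K = K(W)`, a copy of `𝔽₂(s)`. -/
abbrev K₂ : Type := W₂.functionField

/-- `𝔽₂(s) ≃ K(Spec 𝔽₂(s))`. -/
def e₂ : k₂ ≃+* K₂ := specFunctionFieldEquiv k₂

/-- The transcendental `s ∈ K(W)`. -/
def sK : K₂ := e₂ RatFunc.X

/-- `s` is not a square in `𝔽₂(s)` (degree count). [folklore] -/
theorem X_ne_sq (b : k₂) : b ^ 2 ≠ (RatFunc.X : k₂) := by
  intro hb
  have hb0 : b ≠ 0 := by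
    rintro rfl
    exact RatFunc.X_ne_zero (by simpa using hb.symm)
  have hdeg := congrArg RatFunc.intDegree hb
  rw [pow_two, RatFunc.intDegree_mul hb0 hb0, RatFunc.intDegree_X] at hdeg
  omega

/-- `s` is not a square in `K(W)`. [folklore] -/
theorem sK_ne_sq (b : K₂) : b ^ 2 ≠ sK := by
  intro hb
  apply X_ne_sq (e₂.symm b)
  apply e₂.injective
  rw [map_pow, RingEquiv.apply_symm_apply, hb]
  rfl

/-- The Kummer-type polynomial `X² − s ∈ K(W)[X]`. -/
def f₂ : Polynomial K₂ := Polynomial.X ^ 2 - Polynomial.C sK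

theorem f₂_irreducible : Irreducible f₂ :=
  X_pow_sub_C_irreducible_of_prime Nat.prime_two sK_ne_sq

instance : Fact (Irreducible f₂) := ⟨f₂_irreducible⟩

theorem f₂_ne_zero : f₂ ≠ 0 := f₂_irreducible.ne_zero

/-- `L = K(W)[y]/(y² − s) = K(W)(√s)`, a field. -/
abbrev L₂ : Type := AdjoinRoot f₂

instance : CharP K₂ 2 := charP_of_injective_ringHom (f := e₂.toRingHom) e₂.injective 2

theorem finrank_L₂ : Module.finrank K₂ L₂ = 2 := by
  rw [(AdjoinRoot.powerBasis f₂_ne_zero).finrank, AdjoinRoot.powerBasis_dim]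
  exact Polynomial.natDegree_X_pow_sub_C

theorem root_sq : (AdjoinRoot.root f₂) ^ 2 = algebraMap K₂ L₂ sK := by
  have h : AdjoinRoot.mk f₂ (Polynomial.X ^ 2 - Polynomial.C sK) = 0 := AdjoinRoot.mk_self
  rw [map_sub, map_pow, AdjoinRoot.mk_X, AdjoinRoot.mk_C, sub_eq_zero] at h
  rw [h, AdjoinRoot.algebraMap_eq]

instance isPurelyInseparable_L₂ : IsPurelyInseparable K₂ L₂ := by
  haveI : ExpChar K₂ 2 := ExpChar.prime Nat.prime_two
  have htop : IsPurelyInseparable K₂ (IntermediateField.adjoin K₂ {AdjoinRoot.root f₂}) := by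
    rw [IntermediateField.isPurelyInseparable_adjoin_simple_iff_pow_mem (F := K₂) (E := L₂) (q := 2)]
    exact ⟨1, ⟨sK, by rw [pow_one, root_sq]⟩⟩
  rw [IntermediateField.adjoin_root_eq_top] at htop
  exact IntermediateField.topEquiv.isPurelyInseparable

theorem isRegular_W₂ : Scheme.IsRegular W₂ := Scheme.isRegular_Spec (.of k₂)

/-- **The hypotheses of `CleanModels` are inhabited** (non-vacuity, in Lean): `p = 2`, `k = 𝔽₂(s)`,
`W = Spec k → Spec k` the identity, `L = K(W)(√s)`. [folklore] -/
theorem hyps_witness : Hyps 2 k₂ W₂ (𝟙 _) L₂ :=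
  ⟨inferInstance, inferInstance, inferInstance, isRegular_W₂, inferInstance, finrank_L₂⟩

end Witness

open Witness in
/-- **"Toroidal type everywhere" is false**: at the generic point of any model the toroidal clause
needs `0 < m ≤ dim K(V) = 0`. Witness that the hypotheses are met: `p = 2`, `k = 𝔽₂(s)`, `W = Spec k`,
`L = K(W)(√s)` (purely inseparable of degree `2`). So the regular-type disjunct of `CleanModels` is
load-bearing. [folklore] -/
theorem not_cleanModelsToroidalOnly : ¬ CleanModelsToroidalOnly := by
  intro h
  obtain ⟨V, π, hV, hdom, -, -, -, hpt⟩ :=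
    @h 2 Nat.prime_two k₂ _ _ W₂ _ (𝟙 _) L₂ _ _
      inferInstance inferInstance inferInstance isRegular_W₂ inferInstance finrank_L₂
  obtain ⟨y, g, -, -, htor⟩ := hpt (genericPoint V)
  exact toroidalAt_genericPoint_false 2 π g htor

end Summit.ResolutionOfSingularities.ResolutionOfSingularities.Cruxes.CleanModels.Disproof
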